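import Literature.NumberTheory.EllipticCurves.Rank1Residual.Typed.SelmerCardCertificate
import Literature.NumberTheory.EllipticCurves.Rank1Residual.Typed.X10
import Literature.NumberTheory.EllipticCurves.Rank1Residual.Typed.X10ThreeDescentCertificate
import HarnessLib

/-!
# Class X10 at `p = 3`: the `3`-descent certificate in its NATIVE currency `#Sel^(3)(E/ℚ) = 3 ^ r_an` (cell `b2b-bsdres`, unit `b2b-bsdres-x10b`)

HONEST FRAMING (run/shared/lean/b2b/bsd-rank1-residual/, verbatim): the goal of the cell is to
DELETE the COMBINATION-SHAPED residual classes for ALL analytic-rank `≤ 1` elliptic curves over `ℚ`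
— "full BSD formula for every rank `≤ 1` curve in class C" assembled STRICTLY from published
theorems — so that the rank-`≤ 1` remainder becomes exactly the CONSTRUCTION-SHAPED classes, which
are TYPED (missing-input `Prop`s), NOT attempted. This is not "finishing BSD".

Theorems only (no definition, no named fact); pure compositions of tree theorems. The sub-class
X10b := X10 ∧ ¬surj(3) (mod-`3` image = the normaliser of a SPLIT Cartan subgroup, Cremona/Sutherland
label `3Ns`, or of a non-split one, `3Nn`) is CONSTRUCTION-SHAPED as a class (referee G26 / R6.1:
every printed `p`-part theorem at a good ordinary `3` carries (surj), (Im) or (ram), all false here).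
PER CURVE the image-free route is an explicit `3`-descent: its EXACT output is the single line
`dim_𝔽₃ Sel^(3)(E/ℚ) = r`, i.e. `#Sel^(3)(E/ℚ) = 3 ^ r` — for `3Ns` curves by the unit's engine
`desc3ns` (HOME/b2b-bsdres-x10b/X10B-DESC3NS.md, Theorem A: `H¹(ℚ,E[3]) ≅ ker(N : B^×/B^{×3} →
F^×/F^{×3})`, `B = ℚ(P)` the quartic field of a point `P` on one of the two Galois-conjugate lines,
`F = ℚ(√d)`), for `3Nn` curves by the x11b Schaefer–Stoll engine. This file is the X10 consumer of
that line in the same shape as `X11.bsdp_three_of_card_selmerThree_pow` (x11b gen 7,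
`Typed/SelmerCardCertificate.lean`): x10 gen 4's `Typed/X10ThreeDescentCertificate.lean` consumes
the derived statement `Ш(E/ℚ)[3] = 0`; here the passage `#Sel^(3) = 3^{rank}` ⟹ `Ш[3] = 0` is the
tree's PROVED `noPTorsion_of_card_selmerGroup_eq_pow_rank` (Mordell–Weil + the fundamental exact
sequence `0 → E(ℚ)/3E(ℚ) → Sel^(3) → Ш[3] → 0`), so the lane's certificate row can be booked from the
descent output itself.

* `X10.noThreeTorsion_of_card_selmerThree_pow` — on class X10 (so `r_an ≤ 1`, GZK gives
  `rank = r_an`): `#Sel^(3)(E/ℚ) = 3 ^ r_an` ⟹ `Ш(E/ℚ)[3] = 0`.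
* `X10.bsdp_three_of_card_selmerThree_pow` — `ClassX10 W 3 → #Sel^(3)(E/ℚ) = 3 ^ r_an → 3 ∤ #Ш_an → BSDp W 3`
  (named facts: GZK only; NO image hypothesis, NO Iwasawa-theoretic input, NO preprint).
* `X10.missingPPartAt_three_of_card_selmerThree_pow` — the same conclusion in the typed vocabulary
  (`MissingPPartAt W 3`), and `X10.missingInputAt_of_card_selmerThree_pow` — it DISCHARGES the typed
  missing input `X10.MissingInputAt W` of `Typed/X10.lean` at that curve, whatever the mod-`3` image.

Per curve; NOT a class theorem; the lane books certificates (two engines). Census reach (unit x10b,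
Cremona `N < 5·10⁵`): X10b-type = 883 isogeny classes (`3Ns` 610, `3Nn` 273); the rows with
`3 ∣ #Ш_an` (e.g. `10082b1`) are NOT of this shape (there `dim Sel₃ ≥ r + 2` is a lower bound for
`Ш[3]` and no published upper bound exists without (surj)) — the RESISTANT list of X10b.

References: [Miller2011LMS] §1, Def. 1.1; [SilvermanAEC2009] Thm. X.4.2(a); Darmon CBMS 101 Thm. 3.22 (GZK).
-/

set_option autoImplicit false

noncomputable section

open scoped Classical

open WeierstrassCurve Literature.NumberTheory.EllipticCurves
  Literature.NumberTheory.EllipticCurves.Rank1Residual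

namespace Literature.NumberTheory.EllipticCurves.Rank1Residual.Typed

/-- **X10, per curve, native descent currency: `#Sel^(3)(E/ℚ) = 3 ^ r_an` ⟹ `Ш(E/ℚ)[3] = 0`.**
On class X10 the analytic rank is `≤ 1`, so Gross–Zagier–Kolyvagin (`hGZK`) gives
`rank_ℤ E(ℚ) = r_an`, and the tree's `noPTorsion_of_card_selmerGroup_eq_pow_rank` (Mordell–Weil +
`0 → E(ℚ)/3E(ℚ) → Sel^(3) → Ш[3] → 0`) concludes. Image-free: valid on X10a′ and on X10b.
Per curve. [cite: SilvermanAEC2009, Thm X.4.2(a)] -/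
theorem X10.noThreeTorsion_of_card_selmerThree_pow
    (hGZK : rank_eq_analyticRank_of_analyticRank_le_one)
    (W : WeierstrassCurve ℚ) [W.IsElliptic] [W.IsGloballyMinimal] (hX : ClassX10 W 3)
    (hcard : Nat.card (W.selmerGroup (3 : ℤ)) = 3 ^ W.analyticRank) :
    ∀ x : W.sha, (3 : ℤ) • x = 0 → x = 0 := by
  have hrank : W.mordellWeilRank = W.analyticRank := (hGZK W hX.analyticRank_le_one).1
  have h : ∀ x : W.sha, ((3 : ℕ) : ℤ) • x = 0 → x = 0 :=
    noPTorsion_of_card_selmerGroup_eq_pow_rank W 3 (by rw [hrank]; exact_mod_cast hcard)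
  exact_mod_cast h

/-- **X10, per curve: `ClassX10 W 3 → #Sel^(3)(E/ℚ) = 3 ^ r_an → 3 ∤ #Ш_an → BSDp W 3`.** Named fact:
Gross–Zagier–Kolyvagin (`hGZK`). Computed per curve: the lane's exact `#Ш_an` (`hs`, `hv`) and the
EXACT `3`-descent output `hcard` (`dim_𝔽₃ Sel^(3)(E/ℚ) = r_an`; unit x10b's `desc3ns` for `3Ns`,
the x11b Schaefer–Stoll engine for `3Nn`). The class-free composition is the tree's
`bsdp_of_card_selmerGroup_eq_pow_analyticRank`. NO image hypothesis, no Iwasawa-theoretic input,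
no preprint. Per curve; NOT a class theorem. [cite: Miller2011LMS, §1 and Def. 1.1] -/
theorem X10.bsdp_three_of_card_selmerThree_pow
    (hGZK : rank_eq_analyticRank_of_analyticRank_le_one)
    (W : WeierstrassCurve ℚ) [W.IsElliptic] [W.IsGloballyMinimal] (hX : ClassX10 W 3)
    {s : ℚ} (hs : shaAn W = (s : ℂ)) (hv : padicValRat 3 s = 0)
    (hcard : Nat.card (W.selmerGroup (3 : ℤ)) = 3 ^ W.analyticRank) : BSDp W 3 :=
  bsdp_of_card_selmerGroup_eq_pow_analyticRank W 3 hGZK hX.analyticRank_le_one hs hv hcard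

/-- **The typed form**: on class X10, `#Sel^(3)(E/ℚ) = 3 ^ r_an` and `3 ∤ #Ш_an` give
`MissingPPartAt W 3` (the exact `3`-part statement of `Typed/Basic.lean`). Per curve.
[cite: Miller2011LMS, §1 Def. 1.1] -/
theorem X10.missingPPartAt_three_of_card_selmerThree_pow
    (hGZK : rank_eq_analyticRank_of_analyticRank_le_one)
    (W : WeierstrassCurve ℚ) [W.IsElliptic] [W.IsGloballyMinimal] (hX : ClassX10 W 3)
    {s : ℚ} (hs : shaAn W = (s : ℂ)) (hv : padicValRat 3 s = 0)
    (hcard : Nat.card (W.selmerGroup (3 : ℤ)) = 3 ^ W.analyticRank) : MissingPPartAt W 3 :=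
  X10.missingPPartAt_three_of_noThreeTorsion hGZK W hX
    (X10.noThreeTorsion_of_card_selmerThree_pow hGZK W hX hcard) hs hv

/-- **Discharging the typed missing input of `Typed/X10.lean` per curve**: on class X10 the
certificate `#Sel^(3)(E/ℚ) = 3 ^ r_an` with `3 ∤ #Ш_an` gives `X10.MissingInputAt W`
(`¬Surj W 3 → MissingPPartAt W 3`) — so on an X10b pair carrying the certificate nothing is missing.
Per curve; bookkeeping. [cite: Miller2011LMS, §1 Def. 1.1] -/
theorem X10.missingInputAt_of_card_selmerThree_pow
    (hGZK : rank_eq_analyticRank_of_analyticRank_le_one)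
    (W : WeierstrassCurve ℚ) [W.IsElliptic] [W.IsGloballyMinimal] (hX : ClassX10 W 3)
    {s : ℚ} (hs : shaAn W = (s : ℂ)) (hv : padicValRat 3 s = 0)
    (hcard : Nat.card (W.selmerGroup (3 : ℤ)) = 3 ^ W.analyticRank) : X10.MissingInputAt W :=
  fun _ => X10.missingPPartAt_three_of_card_selmerThree_pow hGZK W hX hs hv hcard

end Literature.NumberTheory.EllipticCurves.Rank1Residual.Typed

end
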